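import Summits.QuantumFields.GaugeBoot.StrongCouplingDoublePlaquette
import HarnessLib

/-!
# Strong coupling from the loop equation: `SU(3)` trace identities for doubly and triply wound loops, and merge sums with a plaquette spectator (gauge-boot, ADDENDUM 24 part F, file 1/2)

HONEST FRAMING (cell `pub-gaugeboot`, page 1 of every file): the venture produces certified bounds
on lattice expectations at stated coupling, gauge group, dimension and torus size; NOT a mass gap,
NOT a continuum limit, NOT a string tension; NOT Yang–Mills-summit-bearing (barriers
`FixedCouplingUltralocality`, `PerturbativeInvisibility`).  Pure algebra: pointwise identities on configurations and
pointwise merge sums; no measure, no number.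

## Content

* `su3_trace_append_self` — ★ for lattice `SU(3)` and a CLOSED word `X` at `x`:
  `tr hol(X·X) = (tr hol X)² − 2·tr hol(X⁻¹)` (Newton: `e₂(U) = tr U⁻¹` for `det U = 1`);
* `su3_trace_append_self_mul` — ★ `tr(ρ(hol(X·X))·ρ(hol X)) = (tr hol X)³ − 3·tr hol X·tr hol(X⁻¹) + 3` (Cayley–Hamilton);
  the same statements as the tree's `SU3TraceIdentities` / `SU3KinematicalRows` (whose modules are outside this file's
  import closure), written with the reversed word `X⁻¹` in place of `conj`, re-derived from `Matrix.adjugate_fin_three`;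
* `sum_mergeTerm_spectator_plaqWord` / `…_reverse` — merge sums of ANY marked word `w` with the plaquette `P̃₀` resp.
  `P̃₀⁻¹` as spectator (generalising `sum_mergeTerm_self/_reverse` of `StrongCouplingDoublePlaquette`):
  `tr(ρ(hol w)·ρ(hol P̃₀)) − (s/N)·tr hol w·tr hol P̃₀` resp. `−(tr(ρ(hol w)·ρ(hol P̃₀⁻¹)) − (s/N)·tr hol w·tr hol P̃₀⁻¹)`.

References: S. Mandelstam, Phys. Rev. D 19 (1979) 2391 (`SU(3)` trace identities); V. Kazakov, Z. Zheng,
arXiv:2404.16925 §2.3.  Everything is `[folklore]`.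
-/

noncomputable section

open scoped Matrix
open Literature.MathematicalPhysics.QuantumFieldTheory Literature.MathematicalPhysics.QuantumLattice
open Summit.QuantumFields.YangMills.Cruxes.CurvatureAmnesia.WardDefect.SchwingerDyson

namespace Summit.QuantumFields.GaugeBoot

namespace StrongCoupling

/-! ## `3 × 3` matrix algebra (private copies of the tree's `SU3TraceIdentities`, outside this import closure) -/

section MatrixAlgebra

variable {R : Type*} [CommRing R]

/-- `e₂` of a `3 × 3` matrix (sum of principal `2 × 2` minors). [folklore] -/
private def symm2Aux (M : Matrix (Fin 3) (Fin 3) R) : R :=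
  M 0 0 * M 1 1 - M 0 1 * M 1 0 + (M 0 0 * M 2 2 - M 0 2 * M 2 0) + (M 1 1 * M 2 2 - M 1 2 * M 2 1)

/-- `tr (adj M) = e₂(M)`. [folklore] -/
private theorem trace_adjugate_fin_three_aux (M : Matrix (Fin 3) (Fin 3) R) : (Matrix.adjugate M).trace = symm2Aux M := by
  rw [Matrix.adjugate_fin_three]
  simp [Matrix.trace, Fin.sum_univ_three, symm2Aux]
  ring

/-- Newton: `2 e₂(M) = (tr M)² − tr(M²)`. [folklore] -/
private theorem two_mul_symm2Aux (M : Matrix (Fin 3) (Fin 3) R) : 2 * symm2Aux M = M.trace ^ 2 - (M * M).trace := by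
  simp only [Matrix.trace, Fin.sum_univ_three, Matrix.diag_apply, Matrix.mul_apply, symm2Aux]
  ring

/-- `tr M⁻¹ = e₂(M)` when `det M = 1`. [folklore] -/
private theorem trace_inv_fin_three_aux (M : Matrix (Fin 3) (Fin 3) R) (h : M.det = 1) : (M⁻¹).trace = symm2Aux M := by
  rw [Matrix.inv_def, h, Ring.inverse_one, one_smul, trace_adjugate_fin_three_aux]

/-- Cayley–Hamilton for `3 × 3` matrices: `M³ = (tr M)·M² − e₂(M)·M + (det M)·1`. [folklore] -/
private theorem pow_three_eq_fin_three_aux (M : Matrix (Fin 3) (Fin 3) R) :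
    M ^ 3 = M.trace • M ^ 2 - symm2Aux M • M + M.det • (1 : Matrix (Fin 3) (Fin 3) R) := by
  ext i j
  fin_cases i <;> fin_cases j <;>
    simp [pow_succ, Matrix.mul_apply, Fin.sum_univ_three, symm2Aux, Matrix.det_fin_three, Matrix.trace] <;> ring

/-- **`det M = 1`: `tr(M·M) = (tr M)² − 2·tr M⁻¹`.** [folklore] -/
theorem trace_mul_self_of_det_eq_one (M : Matrix (Fin 3) (Fin 3) R) (h : M.det = 1) :
    (M * M).trace = M.trace * M.trace - 2 * (M⁻¹).trace := by
  rw [trace_inv_fin_three_aux M h, two_mul_symm2Aux]; ring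

/-- **`det M = 1`: `tr(M·M·M) = (tr M)³ − 3·tr M·tr M⁻¹ + 3`.** [folklore] -/
theorem trace_mul_self_mul_self_of_det_eq_one (M : Matrix (Fin 3) (Fin 3) R) (h : M.det = 1) :
    (M * M * M).trace = M.trace * M.trace * M.trace - 3 * (M.trace * (M⁻¹).trace) + 3 := by
  have h3 : M * M * M = M ^ 3 := by rw [pow_succ, pow_two]
  rw [h3, pow_three_eq_fin_three_aux, h, one_smul, Matrix.trace_add, Matrix.trace_sub, Matrix.trace_smul, Matrix.trace_smul,
    Matrix.trace_one, Fintype.card_fin, smul_eq_mul, smul_eq_mul, ← trace_inv_fin_three_aux M h, pow_two,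
    trace_mul_self_of_det_eq_one M h]
  push_cast
  ring

end MatrixAlgebra

/-! ## The identities on `SU(3)` configurations -/

section SU3Words

variable {d L : ℕ}

/-- The matrix of `g⁻¹` in the fundamental representation of `SU(3)` is the matrix inverse. [folklore] -/
theorem fundamentalRep_inv_eq_matrix_inv (g : Matrix.specialUnitaryGroup (Fin 3) ℂ) :
    fundamentalRep (Fin 3) g⁻¹ = (fundamentalRep (Fin 3) g)⁻¹ := by
  have hU : (g : Matrix (Fin 3) (Fin 3) ℂ) ∈ Matrix.unitaryGroup (Fin 3) ℂ := g.2.1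
  have hinv : (g : Matrix (Fin 3) (Fin 3) ℂ)⁻¹ = star (g : Matrix (Fin 3) (Fin 3) ℂ) :=
    Matrix.inv_eq_left_inv (Matrix.mem_unitaryGroup_iff'.1 hU)
  rw [fundamentalRep_apply, fundamentalRep_apply, hinv, ← Matrix.star_eq_inv, Matrix.specialUnitaryGroup.coe_star]

/-- ★ **`SU(3)`, closed word `X` at `x`: `tr hol(X·X) = (tr hol X)² − 2·tr hol(X⁻¹)`.** [folklore] -/
theorem su3_trace_append_self (U : GaugeConfig d L (Matrix.specialUnitaryGroup (Fin 3) ℂ)) (x : Site d L) (X : Word d)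
    (hX : Word.endpoint x X = x) :
    (fundamentalRep (Fin 3) (wordHolonomy U x (X ++ X))).trace =
      (fundamentalRep (Fin 3) (wordHolonomy U x X)).trace * (fundamentalRep (Fin 3) (wordHolonomy U x X)).trace -
        2 * (fundamentalRep (Fin 3) (wordHolonomy U x X.reverse)).trace := by
  have hdet : (fundamentalRep (Fin 3) (wordHolonomy U x X)).det = 1 := by
    rw [fundamentalRep_apply]; exact (wordHolonomy U x X).2.2
  have hrev : wordHolonomy U x X.reverse = (wordHolonomy U x X)⁻¹ := by
    have h := wordHolonomy_reverse U x X; rwa [hX] at h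
  rw [wordHolonomy_append, hX, map_mul, hrev, fundamentalRep_inv_eq_matrix_inv]
  exact trace_mul_self_of_det_eq_one _ hdet

/-- ★ **`SU(3)`, closed word `X` at `x`: `tr(ρ(hol(X·X))·ρ(hol X)) = (tr hol X)³ − 3·tr hol X·tr hol(X⁻¹) + 3`.** [folklore] -/
theorem su3_trace_append_self_mul (U : GaugeConfig d L (Matrix.specialUnitaryGroup (Fin 3) ℂ)) (x : Site d L) (X : Word d)
    (hX : Word.endpoint x X = x) :
    (fundamentalRep (Fin 3) (wordHolonomy U x (X ++ X)) * fundamentalRep (Fin 3) (wordHolonomy U x X)).trace =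
      (fundamentalRep (Fin 3) (wordHolonomy U x X)).trace * (fundamentalRep (Fin 3) (wordHolonomy U x X)).trace *
          (fundamentalRep (Fin 3) (wordHolonomy U x X)).trace -
        3 * ((fundamentalRep (Fin 3) (wordHolonomy U x X)).trace * (fundamentalRep (Fin 3) (wordHolonomy U x X.reverse)).trace) + 3 := by
  have hdet : (fundamentalRep (Fin 3) (wordHolonomy U x X)).det = 1 := by
    rw [fundamentalRep_apply]; exact (wordHolonomy U x X).2.2
  have hrev : wordHolonomy U x X.reverse = (wordHolonomy U x X)⁻¹ := by
    have h := wordHolonomy_reverse U x X; rwa [hX] at h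
  rw [wordHolonomy_append, hX, map_mul, hrev, fundamentalRep_inv_eq_matrix_inv]
  exact trace_mul_self_mul_self_of_det_eq_one _ hdet

end SU3Words

/-! ## Merge sums of an arbitrary marked word with spectator `P̃₀^{±1}` -/

section Merge

variable {d L N : ℕ} {G : Type} [Group G] {ρ : G →* Matrix (Fin N) (Fin N) ℂ}

variable (ρ) in
/-- ★ **Merge sum, spectator `P̃₀`, any marked word `w`** at `(x, μ)`: only the first letter of `P̃₀` joins,
`Σ_{k'} mergeTerm_{k'}(w, P̃₀) = tr(ρ(hol w)·ρ(hol P̃₀)) − (s/N)·tr ρ(hol w)·tr ρ(hol P̃₀)`. [folklore] -/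
theorem sum_mergeTerm_spectator_plaqWord (hL : (1 : ZMod L) ≠ 0) (s : ℂ) (x : Site d L) {μ ν₀ : Fin d} (hμν₀ : μ ≠ ν₀)
    (U : GaugeConfig d L G) (w : Word d) :
    ∑ k ∈ Finset.range (plaqWord μ ν₀ true).length, mergeTerm ρ s x μ U w x (plaqWord μ ν₀ true) k =
      (ρ (wordHolonomy U x w) * ρ (wordHolonomy U x (plaqWord μ ν₀ true))).trace -
        s / N * ((ρ (wordHolonomy U x w)).trace * (ρ (wordHolonomy U x (plaqWord μ ν₀ true))).trace) := by
  have hP : plaqWord μ ν₀ true = [.fwd μ, .fwd ν₀, .bwd μ, .bwd ν₀] := rfl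
  have hνμ : ν₀ ≠ μ := fun h => hμν₀ h.symm
  rw [show (plaqWord μ ν₀ true).length = 4 from rfl]
  simp only [Finset.sum_range_succ, Finset.sum_range_zero, zero_add]
  have h0 : mergeTerm ρ s x μ U w x (plaqWord μ ν₀ true) 0 =
      (ρ (wordHolonomy U x w) * ρ (wordHolonomy U x (plaqWord μ ν₀ true))).trace -
        s / N * ((ρ (wordHolonomy U x w)).trace * (ρ (wordHolonomy U x (plaqWord μ ν₀ true))).trace) := by
    unfold mergeTerm
    rw [show (plaqWord μ ν₀ true)[0]? = some (.fwd μ) from rfl]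
    simp only [Word.siteAt_zero, Step.edge_fwd, if_true, Step.isFwd_fwd, List.drop_zero, List.take_zero, wordHolonomy_nil,
      map_one, mul_one]
  have h1 : mergeTerm ρ s x μ U w x (plaqWord μ ν₀ true) 1 = 0 :=
    mergeTerm_eq_zero_of_edge_ne s x μ U _ x (v := plaqWord μ ν₀ true) (k := 1) (st := .fwd ν₀) rfl
      (Step.edge_ne_of_axis_ne hνμ)
  have h2 : mergeTerm ρ s x μ U w x (plaqWord μ ν₀ true) 2 = 0 :=
    mergeTerm_eq_zero_of_edge_ne s x μ U _ x (v := plaqWord μ ν₀ true) (k := 2) (st := .bwd μ) rfl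
      (Step.bwd_edge_ne (site_ne_of_apply_ne ν₀ (by
        simp only [hP, Word.siteAt, List.take_succ_cons, List.take_zero, Word.endpoint_cons, Word.endpoint_nil,
          Step.apply_fwd, Site.shift, Pi.add_apply, Pi.sub_apply, Pi.single_eq_same, Pi.single_eq_of_ne hνμ]
        exact zmod_ne_of_sub_eq_one hL (by ring))))
  have h3 : mergeTerm ρ s x μ U w x (plaqWord μ ν₀ true) 3 = 0 :=
    mergeTerm_eq_zero_of_edge_ne s x μ U _ x (v := plaqWord μ ν₀ true) (k := 3) (st := .bwd ν₀) rfl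
      (Step.edge_ne_of_axis_ne hνμ)
  rw [h0, h1, h2, h3]
  ring

variable (ρ) in
/-- ★ **Merge sum, spectator `P̃₀⁻¹`, any marked word `w`**: only the last letter of `P̃₀⁻¹` joins (backward),
`Σ_{k'} mergeTerm_{k'}(w, P̃₀⁻¹) = −(tr(ρ(hol w)·ρ(hol P̃₀⁻¹)) − (s/N)·tr ρ(hol w)·tr ρ(hol P̃₀⁻¹))`. [folklore] -/
theorem sum_mergeTerm_spectator_plaqWord_reverse (hL : (1 : ZMod L) ≠ 0) (s : ℂ) (x : Site d L) {μ ν₀ : Fin d}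
    (hμν₀ : μ ≠ ν₀) (U : GaugeConfig d L G) (w : Word d) :
    ∑ k ∈ Finset.range (plaqWord μ ν₀ true).reverse.length,
        mergeTerm ρ s x μ U w x (plaqWord μ ν₀ true).reverse k =
      -((ρ (wordHolonomy U x w) * ρ (wordHolonomy U x (plaqWord μ ν₀ true).reverse)).trace -
        s / N * ((ρ (wordHolonomy U x w)).trace * (ρ (wordHolonomy U x (plaqWord μ ν₀ true).reverse)).trace)) := by
  have hR : (plaqWord μ ν₀ true).reverse = [.fwd ν₀, .fwd μ, .bwd ν₀, .bwd μ] := plaqWord_true_reverse μ ν₀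
  have hνμ : ν₀ ≠ μ := fun h => hμν₀ h.symm
  rw [hR, show ([.fwd ν₀, .fwd μ, .bwd ν₀, .bwd μ] : Word d).length = 4 from rfl]
  simp only [Finset.sum_range_succ, Finset.sum_range_zero, zero_add]
  have hs3 : Word.siteAt x ([.fwd ν₀, .fwd μ, .bwd ν₀, .bwd μ] : Word d) 3 = x.shift μ := by
    simp only [Word.siteAt, List.take_succ_cons, List.take_zero, Word.endpoint_cons, Word.endpoint_nil, Step.apply_fwd,
      Step.apply_bwd, Site.shift]
    abel
  have hs4 : Word.siteAt x ([.fwd ν₀, .fwd μ, .bwd ν₀, .bwd μ] : Word d) 4 = x := by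
    simp only [Word.siteAt, List.take_succ_cons, List.take_zero, Word.endpoint_cons, Word.endpoint_nil, Step.apply_fwd,
      Step.apply_bwd, Site.shift]
    abel
  have h0 : mergeTerm ρ s x μ U w x [.fwd ν₀, .fwd μ, .bwd ν₀, .bwd μ] 0 = 0 :=
    mergeTerm_eq_zero_of_edge_ne s x μ U _ x (v := [.fwd ν₀, .fwd μ, .bwd ν₀, .bwd μ]) (k := 0) (st := .fwd ν₀) rfl
      (Step.edge_ne_of_axis_ne hνμ)
  have h1 : mergeTerm ρ s x μ U w x [.fwd ν₀, .fwd μ, .bwd ν₀, .bwd μ] 1 = 0 :=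
    mergeTerm_eq_zero_of_edge_ne s x μ U _ x (v := [.fwd ν₀, .fwd μ, .bwd ν₀, .bwd μ]) (k := 1) (st := .fwd μ) rfl
      (Step.fwd_edge_ne (site_ne_of_apply_ne ν₀ (by
        simp only [Word.siteAt, List.take_succ_cons, List.take_zero, Word.endpoint_cons, Word.endpoint_nil,
          Step.apply_fwd, Site.shift, Pi.add_apply, Pi.single_eq_same]
        exact zmod_ne_of_sub_eq_one hL (by ring))))
  have h2 : mergeTerm ρ s x μ U w x [.fwd ν₀, .fwd μ, .bwd ν₀, .bwd μ] 2 = 0 :=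
    mergeTerm_eq_zero_of_edge_ne s x μ U _ x (v := [.fwd ν₀, .fwd μ, .bwd ν₀, .bwd μ]) (k := 2) (st := .bwd ν₀) rfl
      (Step.edge_ne_of_axis_ne hνμ)
  have h3 : mergeTerm ρ s x μ U w x [.fwd ν₀, .fwd μ, .bwd ν₀, .bwd μ] 3 =
      -((ρ (wordHolonomy U x w) * ρ (wordHolonomy U x [.fwd ν₀, .fwd μ, .bwd ν₀, .bwd μ])).trace -
        s / N * ((ρ (wordHolonomy U x w)).trace * (ρ (wordHolonomy U x [.fwd ν₀, .fwd μ, .bwd ν₀, .bwd μ])).trace)) := by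
    unfold mergeTerm
    rw [show ([.fwd ν₀, .fwd μ, .bwd ν₀, .bwd μ] : Word d)[3]? = some (.bwd μ) from rfl]
    have hedge : (Step.bwd μ).edge (Word.siteAt x ([.fwd ν₀, .fwd μ, .bwd ν₀, .bwd μ] : Word d) 3) = (x, μ) := by
      rw [hs3, Step.edge_bwd, Site.shift, add_sub_cancel_right]
    simp only [hedge, if_true, Step.isFwd_bwd, Bool.false_eq_true, if_false, hs4]
    rw [show ([.fwd ν₀, .fwd μ, .bwd ν₀, .bwd μ] : Word d).drop (3 + 1) = [] from rfl,
      show ([.fwd ν₀, .fwd μ, .bwd ν₀, .bwd μ] : Word d).take (3 + 1) = [.fwd ν₀, .fwd μ, .bwd ν₀, .bwd μ] from rfl,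
      wordHolonomy_nil, map_one, Matrix.one_mul]
  rw [h0, h1, h2, h3]
  ring


end Merge

end StrongCoupling

end Summit.QuantumFields.GaugeBoot

end
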